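import Summits.ValiantsHypothesis.ValiantsHypothesis.Theorems.ZeroOneTransfer.Negative.FalseWithoutVP

/-!
# Crux `DivisionGap.ZeroOneTransfer` (stmt-ValiantsHypothesis-5066), line `charged-uncharged` —
stub `monotoneMultiples_false_without_VP`: `VP_ℂ` is load-bearing for the child `MonotoneMultiples`

Support file for crux `stmt-ValiantsHypothesis-5066` (`Theses.DivisionGap.ZeroOneTransfer`, H2 of
route DivisionGap), line `charged-uncharged` (lead c8).  The crux splits as
`MonotoneMultiples ∧ CofactorCharging` (`Theorems/DivisionGapZeroOneTransferSplit.lean`).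
This file is the boundary lemma for the child `MonotoneMultiples` (uncharged transfer: some
nonzero nonnegative multiple `f_n · h` has monotone complexity `≤ 2 ^ ((log₂ n + c) ^ c)`, the
cofactor `h` unpaid): with its `IsVPFamily` hypothesis deleted the statement is FALSE.

Witness (the degree blow-up of `Negative.zeroOneTransfer_false_without_VP`, which refutes the
charged version; its argument only ever uses the summand `L(f_n · h)`): `σ_n = Unit`,
`f_n = X ^ 2 ^ 2 ^ ((2n)^n + 1)` (coefficients `0/1`).  Given the alleged `c`, at `n = c` every
nonzero `h` has `deg (f_c · h) ≥ 2 ^ 2 ^ ((2c)^c + 1)` (`Negative.le_totalDegree_X_pow_mul`), while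
`L(f_c · h) ≤ 2 ^ ((log₂ c + c)^c) ≤ 2 ^ ((2c)^c)` forces `deg ≤ 2 ^ 2 ^ ((2c)^c)`
(`Negative.totalDegree_le_two_pow_complexity`) — contradiction.  No definitions in this file.
-/

noncomputable section

-- Sub = Summit single-conjunct layout: the duplicated namespace component is mandated by the tree.
set_option linter.dupNamespace false

namespace Summit.ValiantsHypothesis.ValiantsHypothesis.Theorems.DivisionGapZeroOneTransfer

open Literature.Computability.AlgebraicComplexity
open Summit.ValiantsHypothesis.ValiantsHypothesis.Theorems.ZeroOneTransfer.Negative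
open MvPolynomial
open scoped NNReal

/-- **`MonotoneMultiples` without `IsVPFamily` is false.**  Witness: `σ_n = Unit`,
`f_n = X ^ 2 ^ 2 ^ ((2n)^n + 1)` (coefficients `0/1`).  Given the alleged `c`, at `n = c` every
nonzero `h` has `deg (f_c h) ≥ 2 ^ 2 ^ ((2c)^c + 1)`, while `L(f_c h) ≤ 2 ^ ((log₂ c + c)^c) ≤
2 ^ ((2c)^c)` forces `deg ≤ 2 ^ 2 ^ ((2c)^c)` — contradiction.  So the `VP_ℂ` hypothesis of the
child `MonotoneMultiples` (its degree clause at least) is load-bearing, exactly as for the crux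
(`Negative.zeroOneTransfer_false_without_VP`). [folklore] -/
theorem monotoneMultiples_false_without_VP :
    ¬ (∀ (σ : ℕ → Type) [∀ n, Fintype (σ n)] (f : ∀ n, MvPolynomial (σ n) NNReal),
        (∀ n m, MvPolynomial.coeff m (f n) = 0 ∨ MvPolynomial.coeff m (f n) = 1) →
        ∃ c : ℕ, ∀ n, ∃ h : MvPolynomial (σ n) NNReal, h ≠ 0 ∧
          Literature.Computability.AlgebraicComplexity.complexity (f n * h) ≤
            2 ^ ((Nat.log 2 n + c) ^ c)) := by
  intro H
  obtain ⟨c, hc⟩ := H (fun _ => Unit)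
    (fun n => (X () : MvPolynomial Unit ℝ≥0) ^ 2 ^ 2 ^ ((2 * n) ^ n + 1))
    (by
      intro n m
      classical
      rw [X_pow_eq_monomial, coeff_monomial]
      split_ifs <;> simp)
  obtain ⟨h, hne, hL⟩ := hc c
  have hlog : Nat.log 2 c + c ≤ 2 * c := by
    have := Nat.log_le_self 2 c
    omega
  have hexp : (Nat.log 2 c + c) ^ c ≤ (2 * c) ^ c := Nat.pow_le_pow_left hlog c
  have hdeg := (le_totalDegree_X_pow_mul () (2 ^ 2 ^ ((2 * c) ^ c + 1)) hne).trans
    (totalDegree_le_two_pow_complexity _)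
  have h1 : 2 ^ 2 ^ ((2 * c) ^ c + 1) ≤ 2 ^ 2 ^ ((2 * c) ^ c) := by
    calc 2 ^ 2 ^ ((2 * c) ^ c + 1) ≤ 2 ^ complexity _ := hdeg
      _ ≤ 2 ^ 2 ^ ((Nat.log 2 c + c) ^ c) := Nat.pow_le_pow_right two_pos hL
      _ ≤ 2 ^ 2 ^ ((2 * c) ^ c) :=
          Nat.pow_le_pow_right two_pos (Nat.pow_le_pow_right two_pos hexp)
  have h2 : 2 ^ ((2 * c) ^ c + 1) ≤ 2 ^ ((2 * c) ^ c) :=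
    (Nat.pow_le_pow_iff_right (by norm_num)).mp h1
  have h3 : (2 * c) ^ c + 1 ≤ (2 * c) ^ c := (Nat.pow_le_pow_iff_right (by norm_num)).mp h2
  omega

end Summit.ValiantsHypothesis.ValiantsHypothesis.Theorems.DivisionGapZeroOneTransfer

end
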